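import Summits.QuantumFields.YangMills.Theorems.BalabanUVNodesN11TopPairLocalResidual
import Summits.QuantumFields.YangMills.Theorems.BalabanUVNodesN11KernelRTSectionIntegrable
import Summits.QuantumFields.YangMills.Theorems.BalabanUVNodesN21StepWeightsPositivity
import Summits.QuantumFields.YangMills.Theorems.BalabanUVNodesN11Sect3SupplyChainObligationsDefs

/-!
EDITION v1.1 (dag-n11-d g31, 2026-08-29; T0′ of the FLAG №1 R2b cure): the four `…_of_tLaw₁₃CoPH_su2` ∕ `…_of_chainFormTAt_su2` readings take, besides the core provisos `h`
(still read for measurability ∕ positivity ∕ unity), the DISPLAYED one-scale law `hzh` of the step-1 residuals — the cure re-types the row `zhLocal` IN PLACE to print's two-scale law,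
which no longer yields it; content unchanged («at every θ whose step-1 residuals are one-scale»).

# DAG node N11 — THE MAIN TERM AT EVERY PARAMETER WITH `Provisos₁₃CoPH` AND A ONE-SCALE STEP-1 RESIDUAL (`hzh`, displayed), READ ON THE GRAPH OF THE AVERAGING: the top pair's 𝐓-slot is `dV′`-a.e. ZERO (the (3.2) front factor kills it off the support), and a
# kernel transport of a NONNEGATIVE bounded measurable integrand family vanishing a.e. forces the integrand to vanish at `(Ū, U)` for `dU`-a.e. `U` (disintegration of product Haar measure
# along the averaging); so at every `θ : Stage13HParams F 2` with `Provisos₁₃CoPH` + `hzh` (NOT implied by the row `zhLocal` since W2∕T1′) + guards + the first 𝐓-law, def-T's STEP WEIGHT OF THE ALL-SMALL LABEL VANISHES AT `(U, Ū)` FOR a.e. FINE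
# FIELD `U` — where every χ₁-cube is (3.2)-small at `Ū` and (3.3)-small at `(U, Ū)`, the residual `ζ₁` gives the all-small labels `(∅,∅,(∅,S))` total weight ZERO (count-neutral, LOCATED)

HEADER — WORK-UNIT METADATA.  Cell `pub-ymgap`, YM-PLAN Track A (HUMAN RULING D-0062), seat `pub-ymgap-dag-n11-d` (g19; N11 [B14], s2), route `BalabanUVNodes`, item K1⁹ =
stmt-QuantumFields-27364 (helper lane, `--kind proof --supports 27364 --as helper`, count-neutral).  [III] = [Balaban1988Convergent], [B7] = [Balaban1985Averaging], [I] = [Balaban1987RG1].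
Over this seat's g19 `…N11TopPairLocalResidual` (★★★★ `main_term_absent_of_O3_of_provisos₁₃CoPH_su2` ∕ ★★★★★ `tLaw₁₃CoPH_zero_top_pair_degenerate_su2`), g18 `…N11TopChildTStep.slotsTOfRecord_succ_top_eq` ∕
`…N11TopChildStepWeight.chiSeqOfRecord_succ_top_eq_prod` ∕ `wOfRecord_top_eq_prod`, dag-n08-w2's `…N11FirstStepSupply.slotsTOfRecord₁₃H_one_apply` (`𝐓ρ₀(s)(V′) = ∫dU δ(ŪV′⁻¹)[w₀(s)(U,V′)ρ₀(U)]`),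
dag-n11-w2's `…N11KernelRTSectionIntegrable.lintegral_graph_eq_lintegral_margDensity_mul` (the `ℝ≥0∞` disintegration along the graph), dag-n21-c's `…N21StepWeightsPositivity.zetaOfRecord_nonneg`
(`IsZetaUnity ∧ IsZetaAbsLeOne ⇒ ζ ≥ 0`), K0's `wOfRecord_nonneg` ∕ `abs_wOfRecord_le_one` ∕ `measurable_wOfRecord` ∕ `rhoZeroOfRecord_pos ∕ _le ∕ measurable_…`, RECORD 13 v1.7 `H`
(`Provisos₁₃CoPH`: rows `zhLocal`, `measω`, `zetaUnity`, `zetaAbs`; `TLaw₁₃CoPH`).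

WHY THIS FILE.  `…N11TopPairLocalResidual` concludes «𝐓-slot `≡ 0` or `= 0` a.e. on `{χ₁ ≠ 0}`» at the top pair; since `𝐓ρ₀(𝕋,𝕋)(V′) = χ₁(V′)·∫dU δ(ŪV′⁻¹)[χ′_0(ALL)·Σ_Sζ₁·ρ₀]`
(g18 B) the slot vanishes for a.e. `V′` OUTRIGHT (§2).  That slot is the kernel transport of the family `f(V′,U) = w₀(s)(U,V′)·ρ₀(U)` (`slotsTOfRecord₁₃H_one_apply`), which is jointly
measurable (row `measω` through K0's `measurable_wOfRecord`), NONNEGATIVE (rows `zetaUnity` + `zetaAbs` force `ζ ≥ 0`, `zetaOfRecord_nonneg`; `ρ₀ > 0`) and bounded (`|w| ≤ 1`, `ρ₀ ≤ e^{−E}`).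
§1 is the generic measure-theoretic step: for such a family, «`∫ f(V,·) dκ_V · h(V) = 0` for `dV`-a.e. `V`» ⇒ «`f(Ū, U) = 0` for `dU`-a.e. `U`» — the product Haar measure of the fine
field disintegrates along the averaging into the fibre laws `κ_V` weighted by the marginal density `h` (`lintegral_graph_eq_lintegral_margDensity_mul`), each fibre law is a probability
measure, and a nonnegative integrable function with zero integral vanishes a.e.  Hence (§2–§3): at every `θ` with `Provisos₁₃CoPH` + `hzh`, the numerics guards and the (O3′) clause ∕ the first
𝐓-law, `w₀(𝕋,𝕋)(U, Ū) = 0` for `dU`-a.e. `U`; unfolding n02-b's weight (`a(∅)(Ū)·χ′_0(ALL)(U,Ū)·Σ_S ζ₁(∅,∅,(∅,S))(U,Ū)`): on the ALL-SMALL CLASS — every χ₁-cube (3.2)-small at `Ū` and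
(3.3)-small at `(U, Ū)` — the residual fluctuation factor gives the all-small labels total weight `0`, i.e. (unity) it declares a large fluctuation (`R ≠ ∅`) with total weight `1`,
for a.e. such `U`.  Print's `ζ(∅,∅,(∅,·))` there is `1` on the bulk of the measure ([III] (3.16), [I] Thm 1).

WHAT THIS FILE PROVES (0 `def`, 0 `sorry`, standard axioms).  §1 (generic carriers) ★★★ `ae_graph_eq_zero_of_kernelTransport_ae_zero`.  §2 (record, every `N`) ★★ `slotsT_one_top_ae_zero_of_degenerate`
(degenerate ⇒ a.e. zero outright) · `measurable_topWeight_mul_rho` · `topWeight_mul_rho_nonneg` · `topWeight_mul_rho_le` · ★★★★★★ `wOfRecord_top_ae_zero_on_graph_of_degenerate` · ★★★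
`sum_zeta_allSmall_ae_zero_on_graph_of_degenerate`.  §3 (`SU(2)`, guards only, `Provisos₁₃CoPH` + `hzh`) ★★★★★★★ `wOfRecord_top_ae_zero_on_graph_of_tLaw₁₃CoPH_su2` · ★★★★
`sum_zeta_allSmall_ae_zero_on_graph_of_tLaw₁₃CoPH_su2` · ★★★★ `sum_zeta_largeFluct_ae_eq_one_on_allSmall_of_tLaw₁₃CoPH_su2` (unity: `Σ_{(R,S), R ≠ ∅} ζ₁(∅,∅,(R,S))(U,Ū) = 1` a.e. on the all-small class) ·
★★★★★ `wOfRecord_top_ae_zero_on_graph_of_chainFormTAt_su2` (chain currency: every supplier with `ChainFormTAt θ p σ 0`).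

HONEST FRAMING.  A NECESSARY-CONDITION reading on the tree's own rows and objects (count-neutral, LOCATED; repair census in `…N11TopPairLocalResidual`'s header): nothing of Bałaban asserted
or refuted; K1⁹'s `∃θ` NOT refuted (a lawful `θ.ζ` may put the `(∅,∅)` unity mass on `R ≠ ∅` labels; whether the all-small class itself is null is NOT claimed — no positivity of transports
on the solvable branch); N11 NOT discharged; K1⁹ NOT closed; no registered stub touched; counts unmoved (typed 28∕28 · discharged 6∕27 · A 6∕28); NOT ℝ⁴ ∕ OS ∕ mass gap ∕ Clay.  No
`sorry`, `axiom`, `def`, `instance`, `notation`.  Sources (SHAPE only): [III] Thm 1 p.262, (2.17)–(2.18) p.257, (3.1)–(3.5) pp.264–265, (3.16) p.268, (3.20)–(3.21) p.269, (3.25) p.270;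
[B7] (10) p.19, Prop. 2 (52)–(54) p.26; [I] Thm 1 p.259.
-/

noncomputable section

open MeasureTheory ProbabilityTheory
open scoped BigOperators Matrix.Norms.L2Operator ENNReal NNReal

namespace Summit.QuantumFields.YangMills.Theorems.BalabanUVNodesN11TopPairStepWeightDeadOnGraph

open Literature.MathematicalPhysics.QuantumFieldTheory.Balaban1983to89 T4Continuum Node00 Node00.Tk B14.Eq218Concrete B14.Sect3Decomp
open Literature.MathematicalPhysics.QuantumFieldTheory.Balaban1983to89.T4AveragingDisintegration (transportK kernelTransport margDensity condLaw measurable_margDensity)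
open Literature.MathematicalPhysics.QuantumFieldTheory.Balaban1983to89.ExpMeanLog (deltaSU)
open B14.Eq213MaximalDomains (side)
open BalabanUVNodesN11AllLargeFieldLabel (sideD_pos sideχ_pos)
open BalabanUVNodesN11TopChildStepWeight (wOfRecord_top_eq_prod chiSeqOfRecord_succ_top_eq_prod)
open BalabanUVNodesN11TopChildTStep (slotsTOfRecord_succ_top_eq)
open BalabanUVNodesN11FirstStepSupply (slotsTOfRecord₁₃H_one_apply)
open BalabanUVNodesN11KernelRTSectionIntegrable (lintegral_graph_eq_lintegral_margDensity_mul)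
open BalabanUVNodesN11TopPairLocalResidual (main_term_absent_of_O3_of_provisos₁₃CoPH_su2)
open N21StepWeightsPositivity (zetaOfRecord_nonneg)
open BalabanUVNodesN11Sect3SupplyChainDefs (Sect3Supplier)
open BalabanUVNodesN11Sect3SupplyChainObligationsDefs (ChainFormTAt tLaw₁₃CoPH_of_chainFormTAt)

/-! ## §1. Generic: a nonnegative bounded measurable family whose kernel transport vanishes a.e. vanishes a.e. on the graph -/

section Generic

variable {α β : Type*} [MeasurableSpace α] [MeasurableSpace β] [StandardBorelSpace β] [Nonempty β]

/-- ★★★ **A NONNEGATIVE BOUNDED MEASURABLE INTEGRAND FAMILY WHOSE KERNEL TRANSPORT VANISHES a.e. VANISHES AT `(avg y, y)` FOR a.e. `y`**: `h(v)·∫ f(v,y) κ(v,dy) = 0` for `μ`-a.e. `v`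
⇒ `f(avg y, y) = 0` for `ν`-a.e. `y` (the `ℝ≥0∞` disintegration `∫⁻ g(avg y,y) dν = ∫⁻ h(v)·∫⁻ g(v,y) κ(v,dy) dμ`, each fibre law a probability measure, and a nonnegative integrable
function with zero integral is a.e. zero). [cite: Balaban1985Averaging, (10) p.19 (bookkeeping)] -/
theorem ae_graph_eq_zero_of_kernelTransport_ae_zero (ν : Measure β) [IsFiniteMeasure ν] (μ : Measure α) [SigmaFinite μ]
    {avg : β → α} (havg : Measurable avg) (hac : ν.map avg ≪ μ) {f : α → β → ℝ}
    (hf : Measurable fun z : α × β => f z.1 z.2) (h0 : ∀ v y, 0 ≤ f v y) {C : ℝ} (hC : ∀ v y, f v y ≤ C)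
    (hT : ∀ᵐ v ∂μ, kernelTransport ν μ avg (f v) v = 0) :
    ∀ᵐ y ∂ν, f (avg y) y = 0 := by
  have hmeas : Measurable fun z : α × β => ENNReal.ofReal (f z.1 z.2) := ENNReal.measurable_ofReal.comp hf
  have hg := lintegral_graph_eq_lintegral_margDensity_mul ν μ havg hac hmeas
  have hrhs : ∫⁻ v, (margDensity ν μ avg v : ℝ≥0∞) * ∫⁻ y, ENNReal.ofReal (f v y) ∂(condLaw ν avg v) ∂μ = 0 := by
    refine (lintegral_eq_zero_iff' ?_).2 ?_
    · exact (measurable_margDensity.coe_nnreal_ennreal.mul hmeas.lintegral_kernel_prod_right').aemeasurable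
    · filter_upwards [hT] with v hv
      rcases mul_eq_zero.1 hv with hm | hI
      · have hm' : margDensity ν μ avg v = 0 := by exact_mod_cast hm
        simp only [hm', ENNReal.coe_zero, zero_mul, Pi.zero_apply]
      · have hfm : Measurable (f v) := hf.comp (measurable_const.prodMk measurable_id)
        have hint : Integrable (f v) (condLaw ν avg v) := by
          refine (integrable_const C).mono' hfm.aestronglyMeasurable (Filter.Eventually.of_forall fun y => ?_)
          rw [Real.norm_eq_abs, abs_of_nonneg (h0 v y)]
          exact hC v y
        have hae : f v =ᵐ[condLaw ν avg v] 0 := (integral_eq_zero_iff_of_nonneg (fun y => h0 v y) hint).1 hI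
        have hz : ∫⁻ y, ENNReal.ofReal (f v y) ∂(condLaw ν avg v) = 0 := by
          refine (lintegral_eq_zero_iff (ENNReal.measurable_ofReal.comp hfm)).2 ?_
          filter_upwards [hae] with y hy
          show ENNReal.ofReal (f v y) = 0
          rw [hy, Pi.zero_apply, ENNReal.ofReal_zero]
        simp only [hz, mul_zero, Pi.zero_apply]
  rw [hrhs] at hg
  have hfm' : Measurable fun y => ENNReal.ofReal (f (avg y) y) := hmeas.comp (havg.prodMk measurable_id)
  have hae := (lintegral_eq_zero_iff hfm').1 hg
  filter_upwards [hae] with y hy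
  have hle : f (avg y) y ≤ 0 := ENNReal.ofReal_eq_zero.1 hy
  exact le_antisymm hle (h0 _ _)

end Generic

/-! ## §2. The top pair at the record: a.e.-zero 𝐓-slot; the step weight of the all-small label dies on the graph -/

section Record

variable {F : T4Family} {N : ℕ} [NeZero N] (θ : Stage13HParams F N) (p : B12.RunParams)

/-- ★★ **A DEGENERATE TOP-PAIR 𝐓-SLOT IS a.e. ZERO OUTRIGHT**: «`slotT_1(s′) ≡ 0 ∨ slotT_1(s′) = 0` a.e. on `{χ₁(s′) ≠ 0}`» ⇒ `slotT_1(s′) = 0` `dV′`-a.e. — off the support the (3.2) front factor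
`χ₁(s′) = Π_{□′}χ` kills the slot (g18 `slotsTOfRecord_succ_top_eq`). [cite: Balaban1988Convergent, (3.1)–(3.2) pp.264–265, (3.25) p.270] -/
theorem slotsT_one_top_ae_zero_of_degenerate (hM : 1 ≤ θ.τ9.M) (s' : SeqOfRecord F θ.ν θ.τ9.M (gOfRecord₁₃ F N θ.toStage13Params p) p.K 1)
    (hΩ : s'.Ω 1 = Set.univ) (hΛ : s'.Λ 1 = Set.univ)
    (hdeg : slotsTOfRecord F N θ.ν θ.τ9 (EOfRecord₁₃ F N θ.toStage13Params) (wOfRecord₉ F N θ.toStage9Params) θ.ppSel p (gOfRecord₁₃ F N θ.toStage13Params p) 1 s' = 0 ∨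
      ∀ᵐ V' ∂fieldMeasure (F.P p.K) 1 (SU N),
        chiSeqOfRecord F N θ.ν θ.τ9.M (gOfRecord₁₃ F N θ.toStage13Params p) p.K 1 s' V' ≠ 0 →
          slotsTOfRecord F N θ.ν θ.τ9 (EOfRecord₁₃ F N θ.toStage13Params) (wOfRecord₉ F N θ.toStage9Params) θ.ppSel p (gOfRecord₁₃ F N θ.toStage13Params p) 1 s' V' = 0) :
    ∀ᵐ V' ∂fieldMeasure (F.P p.K) 1 (SU N),
      slotsTOfRecord F N θ.ν θ.τ9 (EOfRecord₁₃ F N θ.toStage13Params) (wOfRecord₉ F N θ.toStage9Params) θ.ppSel p (gOfRecord₁₃ F N θ.toStage13Params p) 1 s' V' = 0 := by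
  rcases hdeg with h0 | hae
  · exact Filter.Eventually.of_forall fun V' => by rw [h0, Pi.zero_apply]
  · filter_upwards [hae] with V' hV'
    by_cases hχ : chiSeqOfRecord F N θ.ν θ.τ9.M (gOfRecord₁₃ F N θ.toStage13Params p) p.K 1 s' V' = 0
    · rw [chiSeqOfRecord_succ_top_eq_prod F N θ.ν θ.τ9.M p (gOfRecord₁₃ F N θ.toStage13Params p) 0 s' hΩ V'] at hχ
      have h := slotsTOfRecord_succ_top_eq F N θ.ν θ.τ9 (EOfRecord₁₃ F N θ.toStage13Params) θ.A₁ θ.ζ θ.ppSel p (gOfRecord₁₃ F N θ.toStage13Params p) 0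
        (sideD_pos θ.ν hM p _ 0) s' hΩ hΛ V'
      rw [hχ, zero_mul] at h
      exact h
    · exact hV' hχ

/-- **THE TOP PAIR's INTEGRAND FAMILY `(V′, U) ↦ w₀(s′)(U,V′)·ρ₀(U)` IS JOINTLY MEASURABLE** (row `measω` through K0's `measurable_wOfRecord`; `ρ₀` measurable).
[cite: Balaban1988Convergent, (3.2)–(3.3) p.265 (bookkeeping)] -/
theorem measurable_topWeight_mul_rho (h : θ.Provisos₁₃CoPH F N) (hK : 0 < p.K) (s' : SeqOfRecord F θ.ν θ.τ9.M (gOfRecord₁₃ F N θ.toStage13Params p) p.K 1) :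
    Measurable fun z : GaugeField (F.P p.K) 1 (SU N) × GaugeField (F.P p.K) 0 (SU N) =>
      wOfRecord₉ F N θ.toStage9Params p (gOfRecord₁₃ F N θ.toStage13Params p) 0 s' z.2 z.1 *
        rhoZeroOfRecord F N p.K (gOfRecord₁₃ F N θ.toStage13Params p 0) (EOfRecord₁₃ F N θ.toStage13Params p) z.2 :=
  (measurable_wOfRecord F N θ.ν θ.τ9.M θ.A₁ θ.ζ p (gOfRecord₁₃ F N θ.toStage13Params p) 0 (h.measω p 0 hK) s').mul
    ((measurable_rhoZeroOfRecord F N p.K _ _).comp measurable_snd)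

/-- **… NONNEGATIVE** (rows `zetaUnity` + `zetaAbs` ⇒ `ζ ≥ 0` ⇒ `w ≥ 0`; `ρ₀ > 0`). [cite: Balaban1988Convergent, (3.16) p.268, (3.21) p.269 (bookkeeping)] -/
theorem topWeight_mul_rho_nonneg (h : θ.Provisos₁₃CoPH F N) (s' : SeqOfRecord F θ.ν θ.τ9.M (gOfRecord₁₃ F N θ.toStage13Params p) p.K 1)
    (V' : GaugeField (F.P p.K) 1 (SU N)) (U : GaugeField (F.P p.K) 0 (SU N)) :
    0 ≤ wOfRecord₉ F N θ.toStage9Params p (gOfRecord₁₃ F N θ.toStage13Params p) 0 s' U V' *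
      rhoZeroOfRecord F N p.K (gOfRecord₁₃ F N θ.toStage13Params p 0) (EOfRecord₁₃ F N θ.toStage13Params p) U :=
  mul_nonneg (wOfRecord_nonneg F N θ.ν θ.τ9.M p (gOfRecord₁₃ F N θ.toStage13Params p) 0 θ.A₁ (zetaOfRecord_nonneg F N θ.ν θ.τ9.M h.zetaUnity h.zetaAbs) s' U V')
    (rhoZeroOfRecord_pos F N p.K _ _ U).le

/-- **… AND BOUNDED BY `e^{−E}`** (`|w| ≤ 1`, `ρ₀ ≤ e^{−E}`). [cite: Balaban1988Convergent, (3.2)–(3.3) p.265, Thm 1 p.262 (bookkeeping)] -/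
theorem topWeight_mul_rho_le (h : θ.Provisos₁₃CoPH F N) (s' : SeqOfRecord F θ.ν θ.τ9.M (gOfRecord₁₃ F N θ.toStage13Params p) p.K 1)
    (V' : GaugeField (F.P p.K) 1 (SU N)) (U : GaugeField (F.P p.K) 0 (SU N)) :
    wOfRecord₉ F N θ.toStage9Params p (gOfRecord₁₃ F N θ.toStage13Params p) 0 s' U V' *
        rhoZeroOfRecord F N p.K (gOfRecord₁₃ F N θ.toStage13Params p 0) (EOfRecord₁₃ F N θ.toStage13Params p) U ≤
      Real.exp (-(EOfRecord₁₃ F N θ.toStage13Params p)) := by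
  have hw : wOfRecord₉ F N θ.toStage9Params p (gOfRecord₁₃ F N θ.toStage13Params p) 0 s' U V' ≤ 1 :=
    (abs_le.1 (abs_wOfRecord_le_one F N θ.ν θ.τ9.M θ.A₁ h.zetaAbs p (gOfRecord₁₃ F N θ.toStage13Params p) 0 s' U V')).2
  have hρ := rhoZeroOfRecord_le F N p.K (gOfRecord₁₃ F N θ.toStage13Params p 0) (EOfRecord₁₃ F N θ.toStage13Params p) U
  have hρ0 := (rhoZeroOfRecord_pos F N p.K (gOfRecord₁₃ F N θ.toStage13Params p 0) (EOfRecord₁₃ F N θ.toStage13Params p) U).le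
  calc _ ≤ 1 * rhoZeroOfRecord F N p.K (gOfRecord₁₃ F N θ.toStage13Params p 0) (EOfRecord₁₃ F N θ.toStage13Params p) U :=
        mul_le_mul_of_nonneg_right hw hρ0
    _ ≤ _ := by rw [one_mul]; exact hρ

/-- ★★★★★★ **AT A DEGENERATE TOP PAIR def-T's STEP WEIGHT OF THE ALL-SMALL LABEL VANISHES ON THE GRAPH**: for every `θ` with `Provisos₁₃CoPH` (rows `measω`, `zetaUnity`, `zetaAbs`), `0 < K`,
`1 ≤ M`, a history `s′ = (𝕋, 𝕋)` whose 𝐓-slot is degenerate: `w₀(s′)(U, Ū) = 0` for `dU`-a.e. fine field `U` (§1 applied to `f(V′,U) = w₀(s′)(U,V′)·ρ₀(U)`, then `ρ₀ > 0`).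
[cite: Balaban1988Convergent, (3.1)–(3.5) pp.264–265, (3.16) p.268, (3.21) p.269, (3.25) p.270; Balaban1985Averaging, (10) p.19] -/
theorem wOfRecord_top_ae_zero_on_graph_of_degenerate (h : θ.Provisos₁₃CoPH F N) (hM : 1 ≤ θ.τ9.M) (hK : 0 < p.K)
    (s' : SeqOfRecord F θ.ν θ.τ9.M (gOfRecord₁₃ F N θ.toStage13Params p) p.K 1) (hΩ : s'.Ω 1 = Set.univ) (hΛ : s'.Λ 1 = Set.univ)
    (hdeg : slotsTOfRecord F N θ.ν θ.τ9 (EOfRecord₁₃ F N θ.toStage13Params) (wOfRecord₉ F N θ.toStage9Params) θ.ppSel p (gOfRecord₁₃ F N θ.toStage13Params p) 1 s' = 0 ∨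
      ∀ᵐ V' ∂fieldMeasure (F.P p.K) 1 (SU N),
        chiSeqOfRecord F N θ.ν θ.τ9.M (gOfRecord₁₃ F N θ.toStage13Params p) p.K 1 s' V' ≠ 0 →
          slotsTOfRecord F N θ.ν θ.τ9 (EOfRecord₁₃ F N θ.toStage13Params) (wOfRecord₉ F N θ.toStage9Params) θ.ppSel p (gOfRecord₁₃ F N θ.toStage13Params p) 1 s' V' = 0) :
    ∀ᵐ U ∂fieldMeasure (F.P p.K) 0 (SU N),
      wOfRecord₉ F N θ.toStage9Params p (gOfRecord₁₃ F N θ.toStage13Params p) 0 s' U ((avOfRecord F N p.K 0).avg U) = 0 := by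
  have hT : ∀ᵐ V' ∂fieldMeasure (F.P p.K) 1 (SU N),
      kernelTransport (fieldMeasure (F.P p.K) 0 (SU N)) (fieldMeasure (F.P p.K) 1 (SU N)) (avOfRecord F N p.K 0).avg
        (fun U => wOfRecord₉ F N θ.toStage9Params p (gOfRecord₁₃ F N θ.toStage13Params p) 0 s' U V' *
          rhoZeroOfRecord F N p.K (gOfRecord₁₃ F N θ.toStage13Params p 0) (EOfRecord₁₃ F N θ.toStage13Params p) U) V' = 0 := by
    filter_upwards [slotsT_one_top_ae_zero_of_degenerate θ p hM s' hΩ hΛ hdeg] with V' hV'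
    rw [slotsTOfRecord₁₃H_one_apply] at hV'
    exact hV'
  have hae := ae_graph_eq_zero_of_kernelTransport_ae_zero (fieldMeasure (F.P p.K) 0 (SU N)) (fieldMeasure (F.P p.K) 1 (SU N))
    (avOfRecord_measurable F N p.K 0) (avOfRecord_haarAC F N p.K 0 hK)
    (f := fun (V' : GaugeField (F.P p.K) 1 (SU N)) (U : GaugeField (F.P p.K) 0 (SU N)) =>
      wOfRecord₉ F N θ.toStage9Params p (gOfRecord₁₃ F N θ.toStage13Params p) 0 s' U V' *
        rhoZeroOfRecord F N p.K (gOfRecord₁₃ F N θ.toStage13Params p 0) (EOfRecord₁₃ F N θ.toStage13Params p) U)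
    (measurable_topWeight_mul_rho θ p h hK s') (topWeight_mul_rho_nonneg θ p h s') (topWeight_mul_rho_le θ p h s') hT
  filter_upwards [hae] with U hU
  rcases mul_eq_zero.1 hU with hw | hρ
  · exact hw
  · exact absurd hρ (rhoZeroOfRecord_pos F N p.K _ _ U).ne'

/-- ★★★ **… SO ON THE ALL-SMALL CLASS THE RESIDUAL GIVES THE ALL-SMALL LABELS TOTAL WEIGHT ZERO**: for `dU`-a.e. `U`, if every χ₁-cube is (3.2)-small at `Ū` and `χ′_0(ALL)(U, Ū) ≠ 0`, then
`Σ_S ζ₁(∅,∅,(∅,S))(U, Ū) = 0` (n02-b's weight `w₀(𝕋,𝕋) = a(∅)·χ′_0(ALL)·Σ_S ζ₁(∅,∅,(∅,S))`). [cite: Balaban1988Convergent, (3.2)–(3.5) p.265, (3.16) p.268, (3.20)–(3.21) p.269] -/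
theorem sum_zeta_allSmall_ae_zero_on_graph_of_degenerate (h : θ.Provisos₁₃CoPH F N) (hM : 1 ≤ θ.τ9.M) (hK : 0 < p.K)
    (s' : SeqOfRecord F θ.ν θ.τ9.M (gOfRecord₁₃ F N θ.toStage13Params p) p.K 1) (hΩ : s'.Ω 1 = Set.univ) (hΛ : s'.Λ 1 = Set.univ)
    (hdeg : slotsTOfRecord F N θ.ν θ.τ9 (EOfRecord₁₃ F N θ.toStage13Params) (wOfRecord₉ F N θ.toStage9Params) θ.ppSel p (gOfRecord₁₃ F N θ.toStage13Params p) 1 s' = 0 ∨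
      ∀ᵐ V' ∂fieldMeasure (F.P p.K) 1 (SU N),
        chiSeqOfRecord F N θ.ν θ.τ9.M (gOfRecord₁₃ F N θ.toStage13Params p) p.K 1 s' V' ≠ 0 →
          slotsTOfRecord F N θ.ν θ.τ9 (EOfRecord₁₃ F N θ.toStage13Params) (wOfRecord₉ F N θ.toStage9Params) θ.ppSel p (gOfRecord₁₃ F N θ.toStage13Params p) 1 s' V' = 0) :
    ∀ᵐ U ∂fieldMeasure (F.P p.K) 0 (SU N),
      (∏ c : Iχ F θ.ν p (gOfRecord₁₃ F N θ.toStage13Params p) 0, chiFactor F N θ.ν p (gOfRecord₁₃ F N θ.toStage13Params p) 0 c ((avOfRecord F N p.K 0).avg U)) ≠ 0 →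
        chiPrime (sect3DataOfRecord F N θ.ν θ.τ9.M p (gOfRecord₁₃ F N θ.toStage13Params p) 0 s'.init) (avOfRecord F N p.K) (2 * deltaOfRecord θ.ν (gOfRecord₁₃ F N θ.toStage13Params p) 0 θ.A₁)
            (Finset.univ : Finset (Iχ F θ.ν p (gOfRecord₁₃ F N θ.toStage13Params p) 0)) U ((avOfRecord F N p.K 0).avg U) ≠ 0 →
          (∑ S : Finset (Iχ F θ.ν p (gOfRecord₁₃ F N θ.toStage13Params p) 0), θ.ζ p (gOfRecord₁₃ F N θ.toStage13Params p) 0 s'.init ∅ ∅ (∅, S) U ((avOfRecord F N p.K 0).avg U)) = 0 := by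
  filter_upwards [wOfRecord_top_ae_zero_on_graph_of_degenerate θ p h hM hK s' hΩ hΛ hdeg] with U hU ha hb
  have hw := hU
  change wOfRecord F N θ.ν θ.τ9.M θ.A₁ θ.ζ p (gOfRecord₁₃ F N θ.toStage13Params p) 0 s' U ((avOfRecord F N p.K 0).avg U) = 0 at hw
  rw [wOfRecord_top_eq_prod F N θ.ν θ.τ9.M θ.A₁ p (gOfRecord₁₃ F N θ.toStage13Params p) 0 θ.ζ (sideD_pos θ.ν hM p _ 0) s' hΩ hΛ U ((avOfRecord F N p.K 0).avg U)] at hw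
  rcases mul_eq_zero.1 hw with h1 | h2
  · rcases mul_eq_zero.1 h1 with h3 | h4
    · exact absurd h3 ha
    · exact absurd h4 hb
  · exact h2

end Record

/-! ## §3. `SU(2)`, guards only, `Provisos₁₃CoPH` + the displayed `hzh`: the first 𝐓-law kills the all-small step weight on the graph -/

section SU2

variable {F : T4Family} (θ : Stage13HParams F 2) (p : B12.RunParams)

/-- (v1.1, T0′ of the FLAG №1 R2b cure: plus the DISPLAYED one-scale law `hzh` of the step-1 residuals, which the re-typed proviso row no longer yields.) ★★★★★★★ **AT EVERY `θ : Stage13HParams F 2` WITH `Provisos₁₃CoPH`, A ONE-SCALE STEP-1 RESIDUAL (`hzh`) AND THE NUMERICS GUARDS, THE FIRST 𝐓-LAW `TLaw₁₃CoPH θ p 0` MAKES def-T's STEP WEIGHT OF THE ALL-SMALL LABEL VANISH AT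
`(U, Ū)` FOR `dU`-a.e. FINE FIELD `U`** (every top pair `s′ = (𝕋, 𝕋)`). [cite: Balaban1988Convergent, Thm 1 p.262, (3.1)–(3.5) pp.264–265, (3.16) p.268, (3.21) p.269, (3.25) p.270, p.267; Balaban1985Averaging, (10) p.19, Prop. 2 (52)–(54) p.26; Balaban1987RG1, Thm 1 p.259] -/
theorem wOfRecord_top_ae_zero_on_graph_of_tLaw₁₃CoPH_su2 (h : θ.Provisos₁₃CoPH F 2) (hzh : ∀ (Ω Λ : ℕ → Set (Site (F.P p.K) 0)) Y ω ω', ω 0 = ω' 0 → (θ.Zh p 1 Ω Λ).ζ0 0 Y ω = (θ.Zh p 1 Ω Λ).ζ0 0 Y ω') (hM : 1 ≤ θ.τ9.M) (hM₂ : 0 < θ.ν.M₂) (hK : 0 < p.K) {α₀ : ℝ} (hα : 0 < α₀)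
    (hα3 : (143 * (((((F.P p.K).d + 4 : ℕ) : ℝ)) ^ 2 / 4) ^ 2) * α₀ ≤ 1 / 3)
    (hα2 : 2 * α₀ ≤ 2 * deltaSU (Fin 2) / ((((F.P p.K).d + 4) * (F.P p.K).L : ℕ) : ℝ) ^ 2)
    (hαε : epsOfRecord θ.ν (gOfRecord₁₃ F 2 θ.toStage13Params p) 1 * (F.P p.K).eta 1 ^ 2 + 4 * (2 * deltaOfRecord θ.ν (gOfRecord₁₃ F 2 θ.toStage13Params p) 0 θ.A₁) ≤
      α₀ * (F.P p.K).eta 1 ^ 2)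
    (hαr : 2 * α₀ * (((F.P p.K).L : ℝ) ^ 1 * (F.P p.K).eta 1) ^ 2 ≤ 2 * θ.ν.εreg)
    (hε₁ : 0 < epsOfRecord θ.ν (gOfRecord₁₃ F 2 θ.toStage13Params p) 1 * (F.P p.K).eta 1 ^ 2) (hmK : 1 ≤ (F.P p.K).m + (F.P p.K).K) (hε : 0 < θ.ν.εreg)
    (hε3 : (143 * (((((F.P p.K).d + 4 : ℕ) : ℝ)) ^ 2 / 4) ^ 2) * θ.ν.εreg ≤ 1 / 3)
    (hε2 : 2 * θ.ν.εreg ≤ 2 * deltaSU (Fin 2) / ((((F.P p.K).d + 4) * (F.P p.K).L : ℕ) : ℝ) ^ 2)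
    (hM1 : 1 ≤ θ.ν.M₁) (h3 : 3 * side (F.P p.K).L θ.ν.M₁ 1 ≤ sideχ F θ.ν p (gOfRecord₁₃ F 2 θ.toStage13Params p) 0)
    (hT : TLaw₁₃CoPH F 2 θ p 0)
    (s' : SeqOfRecord F θ.ν θ.τ9.M (gOfRecord₁₃ F 2 θ.toStage13Params p) p.K 1) (hΩ : s'.Ω 1 = Set.univ) (hΛ : s'.Λ 1 = Set.univ) :
    ∀ᵐ U ∂fieldMeasure (F.P p.K) 0 (SU 2),
      wOfRecord₉ F 2 θ.toStage9Params p (gOfRecord₁₃ F 2 θ.toStage13Params p) 0 s' U ((avOfRecord F 2 p.K 0).avg U) = 0 := by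
  obtain ⟨t, Ek, -, hall⟩ := (tLaw₁₃CoPH_iff F 2 θ p 0).1 hT
  exact wOfRecord_top_ae_zero_on_graph_of_degenerate θ p h hM hK s' hΩ hΛ
    (main_term_absent_of_O3_of_provisos₁₃CoPH_su2 θ p hzh hM hM₂ hK hα hα3 hα2 hαε hαr hε₁ hmK hε hε3 hε2 hM1 h3 s' hΩ hΛ (t s') (Ek s') (hall s').2)

/-- (v1.1, T0′ of the FLAG №1 R2b cure: plus the DISPLAYED one-scale law `hzh` of the step-1 residuals, which the re-typed proviso row no longer yields.) ★★★★ **… SO, a.e. ON THE ALL-SMALL CLASS, THE RESIDUAL `ζ₁` GIVES THE ALL-SMALL LABELS TOTAL WEIGHT ZERO** (every χ₁-cube (3.2)-small at `Ū` and (3.3)-small at `(U, Ū)` ⇒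
`Σ_S ζ₁(∅,∅,(∅,S))(U, Ū) = 0`). [cite: Balaban1988Convergent, Thm 1 p.262, (3.2)–(3.5) p.265, (3.16) p.268, (3.20)–(3.21) p.269; Balaban1985Averaging, (10) p.19] -/
theorem sum_zeta_allSmall_ae_zero_on_graph_of_tLaw₁₃CoPH_su2 (h : θ.Provisos₁₃CoPH F 2) (hzh : ∀ (Ω Λ : ℕ → Set (Site (F.P p.K) 0)) Y ω ω', ω 0 = ω' 0 → (θ.Zh p 1 Ω Λ).ζ0 0 Y ω = (θ.Zh p 1 Ω Λ).ζ0 0 Y ω') (hM : 1 ≤ θ.τ9.M) (hM₂ : 0 < θ.ν.M₂) (hK : 0 < p.K) {α₀ : ℝ} (hα : 0 < α₀)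
    (hα3 : (143 * (((((F.P p.K).d + 4 : ℕ) : ℝ)) ^ 2 / 4) ^ 2) * α₀ ≤ 1 / 3)
    (hα2 : 2 * α₀ ≤ 2 * deltaSU (Fin 2) / ((((F.P p.K).d + 4) * (F.P p.K).L : ℕ) : ℝ) ^ 2)
    (hαε : epsOfRecord θ.ν (gOfRecord₁₃ F 2 θ.toStage13Params p) 1 * (F.P p.K).eta 1 ^ 2 + 4 * (2 * deltaOfRecord θ.ν (gOfRecord₁₃ F 2 θ.toStage13Params p) 0 θ.A₁) ≤
      α₀ * (F.P p.K).eta 1 ^ 2)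
    (hαr : 2 * α₀ * (((F.P p.K).L : ℝ) ^ 1 * (F.P p.K).eta 1) ^ 2 ≤ 2 * θ.ν.εreg)
    (hε₁ : 0 < epsOfRecord θ.ν (gOfRecord₁₃ F 2 θ.toStage13Params p) 1 * (F.P p.K).eta 1 ^ 2) (hmK : 1 ≤ (F.P p.K).m + (F.P p.K).K) (hε : 0 < θ.ν.εreg)
    (hε3 : (143 * (((((F.P p.K).d + 4 : ℕ) : ℝ)) ^ 2 / 4) ^ 2) * θ.ν.εreg ≤ 1 / 3)
    (hε2 : 2 * θ.ν.εreg ≤ 2 * deltaSU (Fin 2) / ((((F.P p.K).d + 4) * (F.P p.K).L : ℕ) : ℝ) ^ 2)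
    (hM1 : 1 ≤ θ.ν.M₁) (h3 : 3 * side (F.P p.K).L θ.ν.M₁ 1 ≤ sideχ F θ.ν p (gOfRecord₁₃ F 2 θ.toStage13Params p) 0)
    (hT : TLaw₁₃CoPH F 2 θ p 0)
    (s' : SeqOfRecord F θ.ν θ.τ9.M (gOfRecord₁₃ F 2 θ.toStage13Params p) p.K 1) (hΩ : s'.Ω 1 = Set.univ) (hΛ : s'.Λ 1 = Set.univ) :
    ∀ᵐ U ∂fieldMeasure (F.P p.K) 0 (SU 2),
      (∏ c : Iχ F θ.ν p (gOfRecord₁₃ F 2 θ.toStage13Params p) 0, chiFactor F 2 θ.ν p (gOfRecord₁₃ F 2 θ.toStage13Params p) 0 c ((avOfRecord F 2 p.K 0).avg U)) ≠ 0 →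
        chiPrime (sect3DataOfRecord F 2 θ.ν θ.τ9.M p (gOfRecord₁₃ F 2 θ.toStage13Params p) 0 s'.init) (avOfRecord F 2 p.K) (2 * deltaOfRecord θ.ν (gOfRecord₁₃ F 2 θ.toStage13Params p) 0 θ.A₁)
            (Finset.univ : Finset (Iχ F θ.ν p (gOfRecord₁₃ F 2 θ.toStage13Params p) 0)) U ((avOfRecord F 2 p.K 0).avg U) ≠ 0 →
          (∑ S : Finset (Iχ F θ.ν p (gOfRecord₁₃ F 2 θ.toStage13Params p) 0), θ.ζ p (gOfRecord₁₃ F 2 θ.toStage13Params p) 0 s'.init ∅ ∅ (∅, S) U ((avOfRecord F 2 p.K 0).avg U)) = 0 := by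
  obtain ⟨t, Ek, -, hall⟩ := (tLaw₁₃CoPH_iff F 2 θ p 0).1 hT
  exact sum_zeta_allSmall_ae_zero_on_graph_of_degenerate θ p h hM hK s' hΩ hΛ
    (main_term_absent_of_O3_of_provisos₁₃CoPH_su2 θ p hzh hM hM₂ hK hα hα3 hα2 hαε hαr hε₁ hmK hε hε3 hε2 hM1 h3 s' hΩ hΛ (t s') (Ek s') (hall s').2)

/-- (v1.1, T0′ of the FLAG №1 R2b cure: plus the DISPLAYED one-scale law `hzh` of the step-1 residuals, which the re-typed proviso row no longer yields.) ★★★★ **… I.E. IT DECLARES A LARGE FLUCTUATION THERE**: by the unity row `Σ_{(R,S)} ζ₁(∅,∅,(R,S)) = 1`, a.e. on the all-small class the labels with `R ≠ ∅` carry total weight `1`.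
[cite: Balaban1988Convergent, Thm 1 p.262, (3.16) p.268, (3.20)–(3.21) p.269; Balaban1985Averaging, (10) p.19] -/
theorem sum_zeta_largeFluct_ae_eq_one_on_allSmall_of_tLaw₁₃CoPH_su2 (h : θ.Provisos₁₃CoPH F 2) (hzh : ∀ (Ω Λ : ℕ → Set (Site (F.P p.K) 0)) Y ω ω', ω 0 = ω' 0 → (θ.Zh p 1 Ω Λ).ζ0 0 Y ω = (θ.Zh p 1 Ω Λ).ζ0 0 Y ω') (hM : 1 ≤ θ.τ9.M) (hM₂ : 0 < θ.ν.M₂) (hK : 0 < p.K) {α₀ : ℝ} (hα : 0 < α₀)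
    (hα3 : (143 * (((((F.P p.K).d + 4 : ℕ) : ℝ)) ^ 2 / 4) ^ 2) * α₀ ≤ 1 / 3)
    (hα2 : 2 * α₀ ≤ 2 * deltaSU (Fin 2) / ((((F.P p.K).d + 4) * (F.P p.K).L : ℕ) : ℝ) ^ 2)
    (hαε : epsOfRecord θ.ν (gOfRecord₁₃ F 2 θ.toStage13Params p) 1 * (F.P p.K).eta 1 ^ 2 + 4 * (2 * deltaOfRecord θ.ν (gOfRecord₁₃ F 2 θ.toStage13Params p) 0 θ.A₁) ≤
      α₀ * (F.P p.K).eta 1 ^ 2)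
    (hαr : 2 * α₀ * (((F.P p.K).L : ℝ) ^ 1 * (F.P p.K).eta 1) ^ 2 ≤ 2 * θ.ν.εreg)
    (hε₁ : 0 < epsOfRecord θ.ν (gOfRecord₁₃ F 2 θ.toStage13Params p) 1 * (F.P p.K).eta 1 ^ 2) (hmK : 1 ≤ (F.P p.K).m + (F.P p.K).K) (hε : 0 < θ.ν.εreg)
    (hε3 : (143 * (((((F.P p.K).d + 4 : ℕ) : ℝ)) ^ 2 / 4) ^ 2) * θ.ν.εreg ≤ 1 / 3)
    (hε2 : 2 * θ.ν.εreg ≤ 2 * deltaSU (Fin 2) / ((((F.P p.K).d + 4) * (F.P p.K).L : ℕ) : ℝ) ^ 2)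
    (hM1 : 1 ≤ θ.ν.M₁) (h3 : 3 * side (F.P p.K).L θ.ν.M₁ 1 ≤ sideχ F θ.ν p (gOfRecord₁₃ F 2 θ.toStage13Params p) 0)
    (hT : TLaw₁₃CoPH F 2 θ p 0)
    (s' : SeqOfRecord F θ.ν θ.τ9.M (gOfRecord₁₃ F 2 θ.toStage13Params p) p.K 1) (hΩ : s'.Ω 1 = Set.univ) (hΛ : s'.Λ 1 = Set.univ) :
    ∀ᵐ U ∂fieldMeasure (F.P p.K) 0 (SU 2),
      (∏ c : Iχ F θ.ν p (gOfRecord₁₃ F 2 θ.toStage13Params p) 0, chiFactor F 2 θ.ν p (gOfRecord₁₃ F 2 θ.toStage13Params p) 0 c ((avOfRecord F 2 p.K 0).avg U)) ≠ 0 →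
        chiPrime (sect3DataOfRecord F 2 θ.ν θ.τ9.M p (gOfRecord₁₃ F 2 θ.toStage13Params p) 0 s'.init) (avOfRecord F 2 p.K) (2 * deltaOfRecord θ.ν (gOfRecord₁₃ F 2 θ.toStage13Params p) 0 θ.A₁)
            (Finset.univ : Finset (Iχ F θ.ν p (gOfRecord₁₃ F 2 θ.toStage13Params p) 0)) U ((avOfRecord F 2 p.K 0).avg U) ≠ 0 →
          (∑ RS ∈ (Finset.univ : Finset (Finset (Iχ F θ.ν p (gOfRecord₁₃ F 2 θ.toStage13Params p) 0) × Finset (Iχ F θ.ν p (gOfRecord₁₃ F 2 θ.toStage13Params p) 0))).filter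
              (fun RS => RS.1 ≠ ∅),
            θ.ζ p (gOfRecord₁₃ F 2 θ.toStage13Params p) 0 s'.init ∅ ∅ RS U ((avOfRecord F 2 p.K 0).avg U)) = 1 := by
  classical
  filter_upwards [sum_zeta_allSmall_ae_zero_on_graph_of_tLaw₁₃CoPH_su2 θ p h hzh hM hM₂ hK hα hα3 hα2 hαε hαr hε₁ hmK hε hε3 hε2 hM1 h3 hT s' hΩ hΛ] with U hU ha hb
  have h0 := hU ha hb
  have hunity := h.zetaUnity p (gOfRecord₁₃ F 2 θ.toStage13Params p) 0 s'.init ∅ ∅ U ((avOfRecord F 2 p.K 0).avg U)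
  -- split the unity sum over `R = ∅` ∕ `R ≠ ∅`
  rw [← Finset.sum_filter_add_sum_filter_not Finset.univ (fun RS : Finset (Iχ F θ.ν p (gOfRecord₁₃ F 2 θ.toStage13Params p) 0) ×
      Finset (Iχ F θ.ν p (gOfRecord₁₃ F 2 θ.toStage13Params p) 0) => RS.1 ≠ ∅)] at hunity
  have hempty : (∑ RS ∈ (Finset.univ : Finset (Finset (Iχ F θ.ν p (gOfRecord₁₃ F 2 θ.toStage13Params p) 0) × Finset (Iχ F θ.ν p (gOfRecord₁₃ F 2 θ.toStage13Params p) 0))).filter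
        (fun RS => ¬ RS.1 ≠ ∅), θ.ζ p (gOfRecord₁₃ F 2 θ.toStage13Params p) 0 s'.init ∅ ∅ RS U ((avOfRecord F 2 p.K 0).avg U)) =
      ∑ S : Finset (Iχ F θ.ν p (gOfRecord₁₃ F 2 θ.toStage13Params p) 0), θ.ζ p (gOfRecord₁₃ F 2 θ.toStage13Params p) 0 s'.init ∅ ∅ (∅, S) U ((avOfRecord F 2 p.K 0).avg U) := by
    refine Finset.sum_nbij' (fun RS => RS.2) (fun S => (∅, S)) ?_ ?_ ?_ ?_ ?_
    · intro RS _; exact Finset.mem_univ _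
    · intro S _; simp
    · intro RS hRS
      simp only [Finset.mem_filter, Finset.mem_univ, true_and, not_not] at hRS
      exact Prod.ext hRS.symm rfl
    · intro S _; rfl
    · intro RS hRS
      simp only [Finset.mem_filter, Finset.mem_univ, true_and, not_not] at hRS
      rw [show RS = (∅, RS.2) from Prod.ext hRS rfl]
  rw [hempty, h0, add_zero] at hunity
  exact hunity

/-- (v1.1, T0′ of the FLAG №1 R2b cure: plus the DISPLAYED one-scale law `hzh` of the step-1 residuals, which the re-typed proviso row no longer yields.) ★★★★★ **CHAIN CURRENCY** (same `θ`: `Provisos₁₃CoPH` + `hzh` + guards): every supplier `σ` with `ChainFormTAt θ p σ 0` (the first 𝐓-law for its own spliced witness, dag-n11-e's `tLaw₁₃CoPH_of_chainFormTAt`) kills def-T's step weight of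
the all-small label on the graph: `w₀(𝕋,𝕋)(U, Ū) = 0` for `dU`-a.e. `U`. [cite: Balaban1988Convergent, Thm 1 p.262, Thm 2 p.263, §3 p.279, (3.1)–(3.5) pp.264–265, (3.16) p.268; Balaban1985Averaging, (10) p.19] -/
theorem wOfRecord_top_ae_zero_on_graph_of_chainFormTAt_su2 (h : θ.Provisos₁₃CoPH F 2) (hzh : ∀ (Ω Λ : ℕ → Set (Site (F.P p.K) 0)) Y ω ω', ω 0 = ω' 0 → (θ.Zh p 1 Ω Λ).ζ0 0 Y ω = (θ.Zh p 1 Ω Λ).ζ0 0 Y ω') (hM : 1 ≤ θ.τ9.M) (hM₂ : 0 < θ.ν.M₂) (hK : 0 < p.K) {α₀ : ℝ} (hα : 0 < α₀)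
    (hα3 : (143 * (((((F.P p.K).d + 4 : ℕ) : ℝ)) ^ 2 / 4) ^ 2) * α₀ ≤ 1 / 3)
    (hα2 : 2 * α₀ ≤ 2 * deltaSU (Fin 2) / ((((F.P p.K).d + 4) * (F.P p.K).L : ℕ) : ℝ) ^ 2)
    (hαε : epsOfRecord θ.ν (gOfRecord₁₃ F 2 θ.toStage13Params p) 1 * (F.P p.K).eta 1 ^ 2 + 4 * (2 * deltaOfRecord θ.ν (gOfRecord₁₃ F 2 θ.toStage13Params p) 0 θ.A₁) ≤
      α₀ * (F.P p.K).eta 1 ^ 2)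
    (hαr : 2 * α₀ * (((F.P p.K).L : ℝ) ^ 1 * (F.P p.K).eta 1) ^ 2 ≤ 2 * θ.ν.εreg)
    (hε₁ : 0 < epsOfRecord θ.ν (gOfRecord₁₃ F 2 θ.toStage13Params p) 1 * (F.P p.K).eta 1 ^ 2) (hmK : 1 ≤ (F.P p.K).m + (F.P p.K).K) (hε : 0 < θ.ν.εreg)
    (hε3 : (143 * (((((F.P p.K).d + 4 : ℕ) : ℝ)) ^ 2 / 4) ^ 2) * θ.ν.εreg ≤ 1 / 3)
    (hε2 : 2 * θ.ν.εreg ≤ 2 * deltaSU (Fin 2) / ((((F.P p.K).d + 4) * (F.P p.K).L : ℕ) : ℝ) ^ 2)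
    (hM1 : 1 ≤ θ.ν.M₁) (h3 : 3 * side (F.P p.K).L θ.ν.M₁ 1 ≤ sideχ F θ.ν p (gOfRecord₁₃ F 2 θ.toStage13Params p) 0)
    (σ : Sect3Supplier θ p) (hform : ChainFormTAt θ p σ 0)
    (s' : SeqOfRecord F θ.ν θ.τ9.M (gOfRecord₁₃ F 2 θ.toStage13Params p) p.K 1) (hΩ : s'.Ω 1 = Set.univ) (hΛ : s'.Λ 1 = Set.univ) :
    ∀ᵐ U ∂fieldMeasure (F.P p.K) 0 (SU 2),
      wOfRecord₉ F 2 θ.toStage9Params p (gOfRecord₁₃ F 2 θ.toStage13Params p) 0 s' U ((avOfRecord F 2 p.K 0).avg U) = 0 :=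
  wOfRecord_top_ae_zero_on_graph_of_tLaw₁₃CoPH_su2 θ p h hzh hM hM₂ hK hα hα3 hα2 hαε hαr hε₁ hmK hε hε3 hε2 hM1 h3 (tLaw₁₃CoPH_of_chainFormTAt hform) s' hΩ hΛ

end SU2

end Summit.QuantumFields.YangMills.Theorems.BalabanUVNodesN11TopPairStepWeightDeadOnGraph

end
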